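import Mathlib.Tactic
import Literature.Computability.QuantumComplexity.JuxtaposedDeciders
import Literature.Computability.QuantumComplexity.BQPMajorityAmplification
import Literature.Computability.QuantumComplexity.SimUniformity
import Literature.Computability.Cryptography.ClassBQP
import Literature.Computability.Complexity.Promise
import Summits.QuantumAdvantage.QuantumAdvantage.Statement
import Summits.QuantumAdvantage.QuantumAdvantage.Theorems.SoloInformedPseudoDeterministicLift
import HarnessLib

/-!
# SoloInformedDecidablePromise — `Q-EXT` holds for problems whose promise is `BQP`-decidable

Solo seat `solo-QuantumAdvantage-informed` (ideation tier, summit-directed). The residual world of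
`SoloInformedLiftDichotomy` is `PSep ∧ ¬Q-EXT`: some `PromiseBQP` problem has no `BPP` solution, but some
(possibly other) `PromiseBQP` problem has no `BQP`-LANGUAGE completion. Here we show that the second
obstruction never concerns problems whose PROMISE `Q.yes ∪ Q.no` is itself a `BQP` language:

* `not_mem_no_of_mem_yes` — a `PromiseBQP` problem is disjoint (`2/3 ≤ p ≤ 1/3` is impossible);
* **`yes_mem_BQP_of_promise_mem_BQP`** — if `Q ∈ PromiseBQP` and `Q.yes ∪ Q.no ∈ BQP` then `Q.yes ∈ BQP`:
  run the (amplified) promise decider and the (amplified) `PromiseBQP` family side by side and accept iff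
  both accept (`Juxt.mem_BQP_of_truthTable` with the `AND` truth table; the error budget is a cylinder of
  the product measure, `Juxt.prod_le_sum_of_cylinder` — off the promise only the promise decider's answer
  is used, on `Q.no` only the family's);
* `mem_promiseLift_BQP_of_promise_mem_BQP` — hence such a `Q` lifts: `Q ∈ promiseLift BQP` (pointwise `Q-EXT`);
* **`quantumAdvantage_of_decidablePromise_witness`** — so a witness of `PromiseBQP ⊄ PromiseBPP` with a
  `BQP`-decidable promise already gives `QuantumAdvantage` (`Q.yes ∈ BQP ∖ BPP`). Equivalently: if
  `BQP ⊆ BPP`, every `PromiseBQP` problem outside `PromiseBPP` has a `BQP`-undecidable promise.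

[cite: BennettBernsteinBrassardVazirani1997, Thm. 4.13 and Cor. 4.15] [cite: Watrous2009, §III.2]
[cite: Goldreich2006, Def. 1.2]
-/

noncomputable section

namespace Summit.QuantumAdvantage.QuantumAdvantage.Theorems

open _root_.Computability Literature.Computability.Complexity Literature.Computability.Complexity.CodeFP
  Literature.Computability.Cryptography Literature.Computability.QuantumComplexity Finset

/-- A `PromiseBQP` problem is disjoint: no input is both a yes- and a no-instance. [cite: Watrous2009, §III.2] -/
theorem not_mem_no_of_mem_yes {Q : PromiseProblem} (hQ : Q ∈ PromiseBQP) {x : List Bool}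
    (hx : x ∈ Q.yes) : x ∉ Q.no := by
  obtain ⟨F, -, -, hFy, hFn⟩ := hQ
  intro hn
  have h1 := hFy x hx
  have h2 := hFn x hn
  linarith

/-- **`PromiseBQP` problems with a `BQP`-decidable promise have their yes-set in `BQP`.** If
`Q ∈ PromiseBQP` and the promise `{x | x ∈ Q.yes ∨ x ∈ Q.no}` is a `BQP` language, then `Q.yes ∈ BQP`:
amplify both tests to error `1/6` (`exists_majority_amplified`, `54` copies), run them side by side
(`Juxt.mem_BQP_of_truthTable`) and accept iff both accept; on `Q.yes` both accept with probability
`≥ (5/6)² ≥ 2/3`, on `Q.no` the second rejects and off the promise the first rejects, each with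
probability `≥ 5/6` (cylinder bounds, `Juxt.prod_le_sum_of_cylinder`).
[cite: BennettBernsteinBrassardVazirani1997, Thm. 4.13 and Cor. 4.15] [cite: Watrous2009, §III.2] -/
theorem yes_mem_BQP_of_promise_mem_BQP {Q : PromiseProblem} (hQ : Q ∈ PromiseBQP)
    (hS : ({x | x ∈ Q.yes ∨ x ∈ Q.no} : Language Bool) ∈ BQP) : Q.yes ∈ BQP := by
  classical
  have hdisj : ∀ x ∈ Q.yes, x ∉ Q.no := fun x hx => not_mem_no_of_mem_yes hQ hx
  obtain ⟨F, hF, hU, hFy, hFn⟩ := hQ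
  obtain ⟨G, hG, hGU, hGx⟩ := ClassBQP.mem_BQP_iff.1 hS
  obtain ⟨F', hF', hU', hF'x⟩ :=
    exists_majority_amplified hF hU (K := 54) (by norm_num) (η := 1 / 6) (by norm_num)
  obtain ⟨G', hG', hGU', hG'x⟩ :=
    exists_majority_amplified hG hGU (K := 54) (by norm_num) (η := 1 / 6) (by norm_num)
  have hF'yes : ∀ x ∈ Q.yes, 5 / 6 ≤ F'.acceptProbOn 0 x := fun x hx => by
    have h := (hF'x x).1 (by have := hFy x hx; linarith)
    norm_num at h
    linarith
  have hF'no : ∀ x ∈ Q.no, F'.acceptProbOn 0 x ≤ 1 / 6 := fun x hx => by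
    have h := (hF'x x).2 (by have := hFn x hx; linarith)
    norm_num at h
    linarith
  have hG'in : ∀ x, (x ∈ Q.yes ∨ x ∈ Q.no) → 5 / 6 ≤ G'.acceptProbOn 0 x := fun x hx => by
    have h := (hG'x x).1 (by have := (hGx x).1 hx; linarith)
    norm_num at h
    linarith
  have hG'out : ∀ x, ¬ (x ∈ Q.yes ∨ x ∈ Q.no) → G'.acceptProbOn 0 x ≤ 1 / 6 := fun x hx => by
    have h := (hG'x x).2 (by have := (hGx x).2 hx; linarith)
    norm_num at h
    linarith
  -- the two tests side by side: block `0` = promise decider, block `1` = the `PromiseBQP` family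
  let fam : Fin 2 → QCircuitFamily cliffordT := fun j => if j = 0 then G' else F'
  have hfam0 : fam 0 = G' := if_pos rfl
  have hfam1 : fam 1 = F' := if_neg (by decide)
  have hfree : ∀ j, (fam j).IsOracleFree :=
    Fin.forall_fin_two.2 ⟨by rw [hfam0]; exact hG', by rw [hfam1]; exact hF'⟩
  have hUfam : ∀ j, (fam j).IsUniform :=
    Fin.forall_fin_two.2 ⟨by rw [hfam0]; exact hGU', by rw [hfam1]; exact hU'⟩
  let Φ : List Bool → (Fin 2 → Bool) → Bool := fun _ γ => γ 0 && γ 1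
  let bit : List Bool → Bool := fun x => decide (x ∈ Q.yes)
  have hbit : ∀ x, bit x = true ↔ x ∈ Q.yes := fun x => by simp only [bit, decide_eq_true_eq]
  have hΦ : CodeFP (pairE strE strE) strE fun p => [Φ p.1 (Juxt.ansBits fam p.1 p.2)] :=
    ((Juxt.codeFP_ansBit fam hUfam 0).and (Juxt.codeFP_ansBit fam hUfam 1)).recodeOut fun _ => rfl
  refine Juxt.mem_BQP_of_truthTable fam hfree hUfam Φ bit hbit hΦ fun x => ?_
  -- error budget, per input, as a cylinder of the product measure
  have hw0 : ∀ j c, 0 ≤ Juxt.answerWeight (fam j) x c := fun j c => Juxt.answerWeight_nonneg _ _ _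
  have hw1 : ∀ j, Juxt.answerWeight (fam j) x true + Juxt.answerWeight (fam j) x false = 1 :=
    fun j => Juxt.answerWeight_true_add_false _ _
  by_cases hy : x ∈ Q.yes
  · -- both tests accept
    have hb : bit x = true := (hbit x).2 hy
    have hcyl := Juxt.prod_le_sum_of_cylinder (fun j c => Juxt.answerWeight (fam j) x c) hw0 hw1
      Finset.univ (fun _ => true) (fun γ => Φ x γ = bit x) fun γ hγ => by
        show (γ 0 && γ 1) = bit x
        rw [hb, hγ 0 (Finset.mem_univ _), hγ 1 (Finset.mem_univ _)]
        rfl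
    refine le_trans ?_ hcyl
    rw [Fin.prod_univ_two]
    show (2 : ℝ) / 3 ≤ Juxt.answerWeight (fam 0) x true * Juxt.answerWeight (fam 1) x true
    rw [hfam0, hfam1]
    simp only [Juxt.answerWeight, if_true]
    have h0 := hG'in x (Or.inl hy)
    have h1 := hF'yes x hy
    nlinarith
  · have hb : bit x = false := by simpa [bit] using hy
    by_cases hn : x ∈ Q.no
    · -- the `PromiseBQP` family rejects
      have hcyl := Juxt.prod_le_sum_of_cylinder (fun j c => Juxt.answerWeight (fam j) x c) hw0 hw1
        {1} (fun _ => false) (fun γ => Φ x γ = bit x) fun γ hγ => by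
          show (γ 0 && γ 1) = bit x
          rw [hb, hγ 1 (Finset.mem_singleton_self _), Bool.and_false]
      refine le_trans ?_ hcyl
      rw [Finset.prod_singleton]
      show (2 : ℝ) / 3 ≤ Juxt.answerWeight (fam 1) x false
      rw [hfam1]
      simp only [Juxt.answerWeight]
      have h1 := hF'no x hn
      norm_num
      linarith
    · -- off the promise the promise decider rejects
      have hcyl := Juxt.prod_le_sum_of_cylinder (fun j c => Juxt.answerWeight (fam j) x c) hw0 hw1
        {0} (fun _ => false) (fun γ => Φ x γ = bit x) fun γ hγ => by
          show (γ 0 && γ 1) = bit x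
          rw [hb, hγ 0 (Finset.mem_singleton_self _), Bool.false_and]
      refine le_trans ?_ hcyl
      rw [Finset.prod_singleton]
      show (2 : ℝ) / 3 ≤ Juxt.answerWeight (fam 0) x false
      rw [hfam0]
      simp only [Juxt.answerWeight]
      have h0 := hG'out x (not_or.2 ⟨hy, hn⟩)
      norm_num
      linarith

/-- **Pointwise `Q-EXT` for decidable promises**: a `PromiseBQP` problem whose promise is a `BQP`
language is solved by a `BQP` language (namely `Q.yes`). [cite: Goldreich2006, Def. 1.2] [cite: Watrous2009, §III.2] -/
theorem mem_promiseLift_BQP_of_promise_mem_BQP {Q : PromiseProblem} (hQ : Q ∈ PromiseBQP)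
    (hS : ({x | x ∈ Q.yes ∨ x ∈ Q.no} : Language Bool) ∈ BQP) : Q ∈ promiseLift BQP :=
  ⟨Q.yes, yes_mem_BQP_of_promise_mem_BQP hQ hS, le_rfl, fun _ hn hy => not_mem_no_of_mem_yes hQ hy hn⟩

/-- **A separating problem with decidable promise gives the summit.** If `Q ∈ PromiseBQP` is solved by no
`BPP` language and its promise `Q.yes ∪ Q.no` is a `BQP` language, then `BQP ⊄ BPP` (witness `Q.yes`).
Contrapositively: if `BQP ⊆ BPP`, every `PromiseBQP` problem outside `PromiseBPP` has a promise that is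
not `BQP`-decidable. [cite: Goldreich2006, Def. 1.2] [cite: Watrous2009, §III.2] -/
theorem quantumAdvantage_of_decidablePromise_witness {Q : PromiseProblem} (hQ : Q ∈ PromiseBQP)
    (hQc : Q ∉ PromiseBPP) (hS : ({x | x ∈ Q.yes ∨ x ∈ Q.no} : Language Bool) ∈ BQP) :
    QuantumAdvantage :=
  ⟨Q.yes, yes_mem_BQP_of_promise_mem_BQP hQ hS, fun hyes =>
    hQc ⟨Q.yes, hyes, le_rfl, fun _ hn hy => not_mem_no_of_mem_yes hQ hy hn⟩⟩

/-- The same with the promise decidable CLASSICALLY (`∈ BPP ⊆ BQP`). [cite: Goldreich2006, Def. 1.2] -/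
theorem quantumAdvantage_of_bppPromise_witness {Q : PromiseProblem} (hQ : Q ∈ PromiseBQP)
    (hQc : Q ∉ PromiseBPP) (hS : ({x | x ∈ Q.yes ∨ x ∈ Q.no} : Language Bool) ∈ BPP) :
    QuantumAdvantage :=
  quantumAdvantage_of_decidablePromise_witness hQ hQc (BPP_subset_BQP_holds hS)

end Summit.QuantumAdvantage.QuantumAdvantage.Theorems

end
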